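import Summits.ValiantsHypothesis.ValiantsHypothesis.Theorems.BarrierLeverPartitionMinorsChowCoreEngine
import Summits.ValiantsHypothesis.ValiantsHypothesis.Theorems.BarrierLeverPartitionMinorsTwinBalancedSplit
import Summits.ValiantsHypothesis.ValiantsHypothesis.Theorems.BarrierLeverPartitionMinorsChowSwap

/-!
# Route BarrierLever — Chow witnesses for partition minors (item 20172, CPM): the two TWIN splits in
# PREDICATE form (any index order), ready for the core engine

Helper file (`--supports stmt-ValiantsHypothesis-20172`; cell valiant-natproofs, rung V4, 𝒟-side of
door (c); seat valiant-natproofs-prover gen 13).  Closes NO item; definition-free.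

For a coordinate `a`, the `a`-TWIN BOTTOMS of a row family `u` are the indices `i` with `a ∉ u i` whose
top `insert a (u i)` is also a row; `tb_a(u)` denotes their number (`u ↦ u \ a` is injective iff
`tb_a(u) = 0`).  The block-form theorems `chow_twinBalancedSplit` (this seat) and `chow_twinSplit`
(val-np-p2 g7) want the twin bottoms LAST and a locator of their tops; here they are repackaged for an
arbitrary injective layout `(u, w)` of height `h + 1`, assuming every injective layout of height `h` is
hit (the induction hypothesis of the core engine):

* `chow_twinBalancedSplit_of_card_eq` — `tb_a(u) = tb_c(w)` ⇒ hit;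
* `chow_twinSplit_of_card_eq` — `tb_a(u) = #{j : c ∈ w j}` ⇒ hit; `chow_twinSplit_of_card_eq'` — the
  transpose `#{i : a ∈ u i} = tb_c(w)` ⇒ hit (via `chow_hit_swap`).

Bookkeeping: `exists_blockPerm` (non-bottoms first, bottoms last), top locators through
`Fin.castLT` (a top is never a bottom, so it sits in the first block), and
`preimage_succAbove_injective_of_not_twinBottom` — deleting `a` is injective on a block WITHOUT twin
bottoms (a collision `u x \ a = u x' \ a`, `u x ≠ u x'`, makes one of them a bottom:
`eq_insert_of_erase_eq`).

WHAT THIS IS NOT: reduction steps only; nothing on items 20172 / 20195 / 19717 themselves, on crux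
stmt-ValiantsHypothesis-14610, or on `VP` versus `VNP`.
-/

set_option linter.dupNamespace false

namespace Summit.ValiantsHypothesis.ValiantsHypothesis.Theorems.BarrierLever.ChowFactor

open Finset MvPolynomial
open Summit.ValiantsHypothesis.ValiantsHypothesis.Theorems.BarrierLever.Compression
  (exists_blockPerm)

noncomputable section

/-! ## 1. Twin bottoms -/

/-- Equal `a`-erasures of two distinct faces: one of them is `insert a` of the other, which avoids `a`. -/
theorem eq_insert_of_erase_eq {n : ℕ} {a : Fin n} {s t : Finset (Fin n)} (he : s.erase a = t.erase a)
    (hne : s ≠ t) : (a ∉ s ∧ t = insert a s) ∨ (a ∉ t ∧ s = insert a t) := by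
  classical
  by_cases hs : a ∈ s <;> by_cases ht : a ∈ t
  · exact absurd (by rw [← Finset.insert_erase hs, ← Finset.insert_erase ht, he]) hne
  · right
    refine ⟨ht, ?_⟩
    rw [← Finset.insert_erase hs, he, Finset.erase_eq_of_notMem ht]
  · left
    refine ⟨hs, ?_⟩
    rw [← Finset.insert_erase ht, ← he, Finset.erase_eq_of_notMem hs]
  · exact absurd (by rw [← Finset.erase_eq_of_notMem hs, ← Finset.erase_eq_of_notMem ht, he]) hne

/-- A peelable coordinate has no twin bottoms. -/
theorem twinBottoms_eq_empty_of_injective {n r : ℕ} (u : Fin r → Finset (Fin n)) (a : Fin n)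
    (hinj : Function.Injective fun i => (u i).erase a) :
    (Finset.univ.filter fun i => a ∉ u i ∧ ∃ i', u i' = insert a (u i)) = ∅ := by
  classical
  refine Finset.eq_empty_of_forall_notMem fun i hi => ?_
  rw [Finset.mem_filter] at hi
  obtain ⟨-, hna, i', hi'⟩ := hi
  have he : (u i').erase a = (u i).erase a := by
    rw [hi', Finset.erase_insert hna, Finset.erase_eq_of_notMem hna]
  have := hinj he
  rw [this] at hi'
  exact hna (hi' ▸ Finset.mem_insert_self a (u i))

/-- A twin bottom and its top have equal `a`-erasures and are different rows. -/
theorem exists_erase_eq_of_twinBottoms_nonempty {n r : ℕ} (u : Fin r → Finset (Fin n)) (a : Fin n)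
    (hne : (Finset.univ.filter fun i => a ∉ u i ∧ ∃ i', u i' = insert a (u i)) ≠ ∅) :
    ∃ i i' : Fin r, (u i).erase a = (u i').erase a ∧ u i ≠ u i' := by
  classical
  obtain ⟨i, hi⟩ := Finset.nonempty_iff_ne_empty.mpr hne
  rw [Finset.mem_filter] at hi
  obtain ⟨-, hna, i', hi'⟩ := hi
  refine ⟨i, i', ?_, ?_⟩
  · rw [hi', Finset.erase_insert hna, Finset.erase_eq_of_notMem hna]
  · intro e
    rw [← e] at hi'
    exact hna (hi' ▸ Finset.mem_insert_self a (u i))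

variable {h : ℕ}

/-- Deleting `a` is injective on an injective block that contains no `a`-twin bottom of the family. -/
theorem preimage_succAbove_injective_of_not_twinBottom {r k : ℕ} (a : Fin (h + 1))
    (u : Fin r → Finset (Fin (h + 1))) (hu : Function.Injective u) (g : Fin k → Fin r)
    (hg : Function.Injective g)
    (hnb : ∀ i : Fin k, ¬ (a ∉ u (g i) ∧ ∃ i', u i' = insert a (u (g i)))) :
    Function.Injective fun i : Fin k =>
      (u (g i)).preimage a.succAbove Fin.succAbove_right_injective.injOn := by
  intro i i' hii
  have he : (u (g i)).erase a = (u (g i')).erase a := by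
    rw [erase_eq_map_preimage_succAbove, erase_eq_map_preimage_succAbove]
    exact congrArg (Finset.map (Fin.succAboveEmb a)) hii
  by_contra hne
  have hne' : u (g i) ≠ u (g i') := fun e => hne (hg (hu e))
  rcases eq_insert_of_erase_eq he hne' with ⟨hna, hins⟩ | ⟨hna, hins⟩
  · exact hnb i ⟨hna, _, hins⟩
  · exact hnb i' ⟨hna, _, hins⟩

/-- **Bottoms last.**  A block permutation putting the `m` twin bottoms of `a` last, with the first
block free of bottoms and a locator `t` of the tops. -/
theorem exists_blockPerm_twinBottoms (a : Fin (h + 1)) {n m : ℕ} (u : Fin (n + m) → Finset (Fin (h + 1)))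
    (hm : (Finset.univ.filter fun i => a ∉ u i ∧ ∃ i', u i' = insert a (u i)).card = m) :
    ∃ (σ : Equiv.Perm (Fin (n + m))) (t : Fin m → Fin n),
      (∀ i : Fin n, ¬ (a ∉ u (σ (Fin.castAdd m i)) ∧ ∃ i', u i' = insert a (u (σ (Fin.castAdd m i))))) ∧
      (∀ i : Fin m, a ∉ u (σ (Fin.natAdd n i))) ∧
      (∀ i : Fin m, u (σ (Fin.castAdd m (t i))) = insert a (u (σ (Fin.natAdd n i)))) := by
  classical
  set Sa := Finset.univ.filter fun i => a ∉ u i ∧ ∃ i', u i' = insert a (u i) with hSa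
  have hSac : Saᶜ.card = n := by rw [Finset.card_compl, hm, Fintype.card_fin]; omega
  obtain ⟨σ, hσ1, hσ2⟩ := exists_blockPerm Saᶜ hSac
  have hfirst : ∀ i : Fin n, ¬ (a ∉ u (σ (Fin.castAdd m i)) ∧
      ∃ i', u i' = insert a (u (σ (Fin.castAdd m i)))) := by
    intro i hb
    have := hσ1 i
    rw [Finset.mem_compl, hSa, Finset.mem_filter] at this
    exact this ⟨Finset.mem_univ _, hb⟩
  have hbot : ∀ i : Fin m, a ∉ u (σ (Fin.natAdd n i)) ∧
      ∃ i', u i' = insert a (u (σ (Fin.natAdd n i))) := by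
    intro i
    have := hσ2 i
    rw [Finset.mem_compl, not_not, hSa, Finset.mem_filter] at this
    exact this.2
  choose top htopeq using fun i => (hbot i).2
  have htopS : ∀ i : Fin m, top i ∈ Saᶜ := by
    intro i
    simp only [Finset.mem_compl, hSa, Finset.mem_filter, Finset.mem_univ, true_and, not_and]
    intro hna
    exact absurd (by rw [htopeq i]; exact Finset.mem_insert_self _ _) hna
  have hlt : ∀ i : Fin m, ((σ.symm (top i) : Fin (n + m)) : ℕ) < n := by
    intro i
    by_contra hge
    push Not at hge
    have hj : ((σ.symm (top i) : Fin (n + m)) : ℕ) - n < m := by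
      have := (σ.symm (top i)).isLt; omega
    have e : Fin.natAdd n ⟨_, hj⟩ = σ.symm (top i) := by
      ext; simp [Fin.natAdd]; omega
    have hmem : σ (Fin.natAdd n ⟨_, hj⟩) ∈ Saᶜ := by
      rw [e, Equiv.apply_symm_apply]; exact htopS i
    exact hσ2 ⟨_, hj⟩ hmem
  refine ⟨σ, fun i => Fin.castLT (σ.symm (top i)) (hlt i), hfirst, fun i => (hbot i).1, fun i => ?_⟩
  rw [Fin.castAdd_castLT, Equiv.apply_symm_apply, htopeq i]

/-! ## 2. The two twin splits in predicate form -/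

/-- **Twin-balanced split, predicate form.**  If `tb_a(u) = tb_c(w)` and every injective layout of
height `h` is hit, then the injective layout `(u, w)` of height `h + 1` is hit. -/
theorem chow_twinBalancedSplit_of_card_eq (a c : Fin (h + 1)) {r : ℕ}
    (u w : Fin r → Finset (Fin (h + 1))) (hu : Function.Injective u) (hw : Function.Injective w)
    (hcard : (Finset.univ.filter fun i => a ∉ u i ∧ ∃ i', u i' = insert a (u i)).card =
      (Finset.univ.filter fun j => c ∉ w j ∧ ∃ j', w j' = insert c (w j)).card)
    (ih : ∀ (r' : ℕ) (u' w' : Fin r' → Finset (Fin h)), Function.Injective u' →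
      Function.Injective w' →
      ∃ ℓ : Fin (h + h) → MvPolynomial (Fin (h + h)) ℂ, (∀ q, (ℓ q).totalDegree ≤ 1) ∧
        (Matrix.of fun i j : Fin r' => coeff
          (∑ b ∈ u' i, Finsupp.single (Fin.castAdd h b) 1 + ∑ d ∈ w' j, Finsupp.single (Fin.natAdd h d) 1)
          (∏ q, ℓ q)).det ≠ 0) :
    ∃ ℓ : Fin ((h + 1) + (h + 1)) → MvPolynomial (Fin ((h + 1) + (h + 1))) ℂ,
      (∀ q, (ℓ q).totalDegree ≤ 1) ∧
      (Matrix.of fun i j : Fin r => coeff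
        (∑ a' ∈ u i, Finsupp.single (Fin.castAdd (h + 1) a') 1 +
          ∑ c' ∈ w j, Finsupp.single (Fin.natAdd (h + 1) c') 1)
        (∏ q, ℓ q)).det ≠ 0 := by
  classical
  obtain ⟨m, hm⟩ : ∃ m, (Finset.univ.filter fun i => a ∉ u i ∧ ∃ i', u i' = insert a (u i)).card = m :=
    ⟨_, rfl⟩
  have hmc : (Finset.univ.filter fun j => c ∉ w j ∧ ∃ j', w j' = insert c (w j)).card = m := by
    rw [← hcard, hm]
  have hmr : m ≤ r := by rw [← hm]; exact (Finset.card_filter_le _ _).trans (by simp)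
  obtain ⟨n, hnr⟩ : ∃ n, r = n + m := ⟨r - m, by omega⟩
  subst hnr
  obtain ⟨σ, t, hσ0, hσb, hσt⟩ := exists_blockPerm_twinBottoms a u hm
  obtain ⟨τ, t', hτ0, hτb, hτt⟩ := exists_blockPerm_twinBottoms c w hmc
  have hU0 := preimage_succAbove_injective_of_not_twinBottom a u hu (fun i => σ (Fin.castAdd m i))
    (fun i j hij => Fin.castAdd_injective _ _ (σ.injective hij)) hσ0
  have hW0 := preimage_succAbove_injective_of_not_twinBottom c w hw (fun j => τ (Fin.castAdd m j))
    (fun i j hij => Fin.castAdd_injective _ _ (τ.injective hij)) hτ0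
  have hU1 := preimage_succAbove_injective_of_not_mem a (fun i : Fin m => u (σ (Fin.natAdd n i)))
    (fun i j hij => Fin.natAdd_injective _ _ (σ.injective (hu hij))) hσb
  have hW1 := preimage_succAbove_injective_of_not_mem c (fun j : Fin m => w (τ (Fin.natAdd n j)))
    (fun i j hij => Fin.natAdd_injective _ _ (τ.injective (hw hij))) hτb
  exact chow_hit_of_perm u w σ τ (chow_twinBalancedSplit a c (fun i => u (σ i)) (fun j => w (τ j))
    t t' hσb hσt hτb hτt (ih n _ _ hU0 hW0) (ih m _ _ hU1 hW1))

/-- **Twin split, predicate form.**  If `tb_a(u) = #{j : c ∈ w j}` and every injective layout of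
height `h` is hit, then the injective layout `(u, w)` of height `h + 1` is hit. -/
theorem chow_twinSplit_of_card_eq (a c : Fin (h + 1)) {r : ℕ}
    (u w : Fin r → Finset (Fin (h + 1))) (hu : Function.Injective u) (hw : Function.Injective w)
    (hcard : (Finset.univ.filter fun i => a ∉ u i ∧ ∃ i', u i' = insert a (u i)).card =
      (Finset.univ.filter fun j => c ∈ w j).card)
    (ih : ∀ (r' : ℕ) (u' w' : Fin r' → Finset (Fin h)), Function.Injective u' →
      Function.Injective w' →
      ∃ ℓ : Fin (h + h) → MvPolynomial (Fin (h + h)) ℂ, (∀ q, (ℓ q).totalDegree ≤ 1) ∧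
        (Matrix.of fun i j : Fin r' => coeff
          (∑ b ∈ u' i, Finsupp.single (Fin.castAdd h b) 1 + ∑ d ∈ w' j, Finsupp.single (Fin.natAdd h d) 1)
          (∏ q, ℓ q)).det ≠ 0) :
    ∃ ℓ : Fin ((h + 1) + (h + 1)) → MvPolynomial (Fin ((h + 1) + (h + 1))) ℂ,
      (∀ q, (ℓ q).totalDegree ≤ 1) ∧
      (Matrix.of fun i j : Fin r => coeff
        (∑ a' ∈ u i, Finsupp.single (Fin.castAdd (h + 1) a') 1 +
          ∑ c' ∈ w j, Finsupp.single (Fin.natAdd (h + 1) c') 1)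
        (∏ q, ℓ q)).det ≠ 0 := by
  classical
  obtain ⟨m, hm⟩ : ∃ m, (Finset.univ.filter fun i => a ∉ u i ∧ ∃ i', u i' = insert a (u i)).card = m :=
    ⟨_, rfl⟩
  have hmc : (Finset.univ.filter fun j => c ∈ w j).card = m := by rw [← hcard, hm]
  have hmr : m ≤ r := by rw [← hm]; exact (Finset.card_filter_le _ _).trans (by simp)
  obtain ⟨n, hnr⟩ : ∃ n, r = n + m := ⟨r - m, by omega⟩
  subst hnr
  have hnc : (Finset.univ.filter fun j => c ∉ w j).card = n := by
    have := card_filter_mem_add_card_filter_not_mem w c; omega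
  obtain ⟨σ, t, hσ0, hσb, hσt⟩ := exists_blockPerm_twinBottoms a u hm
  obtain ⟨τ, hτ1, hτ2⟩ := exists_blockPerm (Finset.univ.filter fun j => c ∉ w j) hnc
  have hw0 : ∀ j : Fin n, c ∉ w (τ (Fin.castAdd m j)) := fun j => by
    have := hτ1 j
    rw [Finset.mem_filter] at this
    exact this.2
  have hw1 : ∀ j : Fin m, c ∈ w (τ (Fin.natAdd n j)) := fun j => by
    have := hτ2 j
    rw [Finset.mem_filter] at this
    by_contra hnc'
    exact this ⟨Finset.mem_univ _, hnc'⟩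
  have hU0 := preimage_succAbove_injective_of_not_twinBottom a u hu (fun i => σ (Fin.castAdd m i))
    (fun i j hij => Fin.castAdd_injective _ _ (σ.injective hij)) hσ0
  have hU1 := preimage_succAbove_injective_of_not_mem a (fun i : Fin m => u (σ (Fin.natAdd n i)))
    (fun i j hij => Fin.natAdd_injective _ _ (σ.injective (hu hij))) hσb
  have hW0 := preimage_succAbove_injective_of_not_mem c (fun j => w (τ (Fin.castAdd m j)))
    (fun i j hij => Fin.castAdd_injective _ _ (τ.injective (hw hij))) hw0
  have hW1 := preimage_succAbove_injective_of_mem c (fun j => w (τ (Fin.natAdd n j)))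
    (fun i j hij => Fin.natAdd_injective _ _ (τ.injective (hw hij))) hw1
  exact chow_hit_of_perm u w σ τ (chow_twinSplit a c (fun i => u (σ i)) (fun j => w (τ j)) t
    hw0 hw1 hσb hσt (ih n _ _ hU0 hW0) (ih m _ _ hU1 hW1))

/-- **Twin split, transposed predicate form** (`#{i : a ∈ u i} = tb_c(w)` ⇒ hit), by the `x ↔ y` swap. -/
theorem chow_twinSplit_of_card_eq' (a c : Fin (h + 1)) {r : ℕ}
    (u w : Fin r → Finset (Fin (h + 1))) (hu : Function.Injective u) (hw : Function.Injective w)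
    (hcard : (Finset.univ.filter fun i => a ∈ u i).card =
      (Finset.univ.filter fun j => c ∉ w j ∧ ∃ j', w j' = insert c (w j)).card)
    (ih : ∀ (r' : ℕ) (u' w' : Fin r' → Finset (Fin h)), Function.Injective u' →
      Function.Injective w' →
      ∃ ℓ : Fin (h + h) → MvPolynomial (Fin (h + h)) ℂ, (∀ q, (ℓ q).totalDegree ≤ 1) ∧
        (Matrix.of fun i j : Fin r' => coeff
          (∑ b ∈ u' i, Finsupp.single (Fin.castAdd h b) 1 + ∑ d ∈ w' j, Finsupp.single (Fin.natAdd h d) 1)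
          (∏ q, ℓ q)).det ≠ 0) :
    ∃ ℓ : Fin ((h + 1) + (h + 1)) → MvPolynomial (Fin ((h + 1) + (h + 1))) ℂ,
      (∀ q, (ℓ q).totalDegree ≤ 1) ∧
      (Matrix.of fun i j : Fin r => coeff
        (∑ a' ∈ u i, Finsupp.single (Fin.castAdd (h + 1) a') 1 +
          ∑ c' ∈ w j, Finsupp.single (Fin.natAdd (h + 1) c') 1)
        (∏ q, ℓ q)).det ≠ 0 :=
  chow_hit_swap u w (chow_twinSplit_of_card_eq c a w u hw hu hcard.symm
    fun r' u' w' hu' hw' => ih r' u' w' hu' hw')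

end

end Summit.ValiantsHypothesis.ValiantsHypothesis.Theorems.BarrierLever.ChowFactor
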